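import Literature.Analysis.FluidPDE.TypeIAncientMild
import Literature.Analysis.FluidPDE.AncientL3BackwardLiouvilleHolds
import Summits.NavierStokesRegularity.NavierStokesRegularity.Theorems.RecurrentProfilesRecurrentLiouvilleLebL3BackwardLiouville
import HarnessLib

/-!
# Route ClockStretchingLaw, crux `ClockCeiling` (stmt-NavierStokesRegularity-10570), line `registered` —
# portrait clause G: backward `L³` blow-up of a nonzero Type-I ancient mild field

`stub_backwardL3Blowup`: if `u` is an element of the Type-I ancient mild class
(`IsTypeIAncientMild C u`: jointly smooth on `t < 0`, divergence free, KNSS/Oseen mild between all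
pairs `s < t < 0`, `‖u(t,x)‖ ≤ C/√(−t)`) which is NOT identically zero on the open slab `t < 0`, then
`‖u(t)‖_{L³(ℝ³)} → +∞` as `t → −∞`, rendered as
`∀ M, ∃ T < 0, ∀ t < T, ENNReal.ofReal M < eLpNorm (u t) 3 volume`.

Proof (Albritton–Barker 2019, Thm 1.2, in contrapositive; pure bookkeeping over tree-proved facts).
If the conclusion fails for some `M`, then below every `T < 0` there is a time `t < T` with
`‖u(t)‖₃ ≤ ofReal M`; choosing one below `−(k+1)` for each `k : ℕ` gives times `τ_k → −∞` with
`‖u(τ_k)‖₃ ≤ ofReal M < ∞`.  The tree's A–B Thm 1.2 in the Type-I-rate Oseen-mild class,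
`lebL3B_liouville_rate` (= `AlbrittonBarker2019_liouville_L3_backward_holds` applied to the bounded
time shifts `u(· − δ)`, `δ > 0`), fed with the class API (`continuousOn_uncurry`, `isWeaklyDivFree`,
`mild_eq_heatExtension`, `hasTypeITimeDecay`), forces `u ≡ 0` on `t < 0` — contradicting the
nonzero hypothesis.

## References

* D. Albritton, T. Barker, *On local Type I singularities of the Navier–Stokes equations and
  Liouville theorems*, J. Math. Fluid Mech. 21 (2019) no. 43 = arXiv:1811.00502, Thm 1.2 (§4).
  [AlbrittonBarker2019]
* G. Koch, N. Nadirashvili, G. Seregin, V. Šverák, *Liouville theorems for the Navier–Stokes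
  equations and applications*, Acta Math. 203 (2009) = arXiv:0709.3599, (1.4), §4 (i).
  [KochNadirashviliSereginSverak2009]
-/

noncomputable section

-- the summit and its single sub-problem share the name (CONVENTIONS §1), as in every Theorems file
set_option linter.dupNamespace false

namespace Summit.NavierStokesRegularity.NavierStokesRegularity.Theorems

open MeasureTheory Set Function Filter Topology
open Literature.Analysis Literature.Analysis.FluidPDE
open scoped NNReal ENNReal

/-- **Portrait clause G — backward `L³` blow-up** (Albritton–Barker 2019, Thm 1.2, contrapositive, in
the Type-I ancient mild class).  A Type-I ancient mild field `u` (`IsTypeIAncientMild C u`) which does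
not vanish identically on `t < 0` has `‖u(t)‖_{L³} → ∞` as `t → −∞`: for every `M` there is `T < 0`
with `ofReal M < ‖u(t)‖_{L³}` for all `t < T`.  Otherwise some `M` bounds `‖u(τ_k)‖₃` along times
`τ_k < −(k+1)`, `τ_k → −∞`, and A–B Thm 1.2 in the rate class (`lebL3B_liouville_rate`, from
`AlbrittonBarker2019_liouville_L3_backward_holds` on the bounded shifts `u(· − δ)`) gives `u ≡ 0`.
[cite: AlbrittonBarker2019, Thm 1.2 (arXiv:1811.00502 p. 4; proof §4 p. 9)] -/
theorem stub_backwardL3Blowup :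
    ∀ (C : ℝ) (u : ℝ → EuclideanSpace ℝ (Fin 3) → EuclideanSpace ℝ (Fin 3)),
      Literature.Analysis.FluidPDE.IsTypeIAncientMild C u → (∃ t < 0, ∃ x, u t x ≠ 0) →
      ∀ M : ℝ, ∃ T < 0, ∀ t < T,
        ENNReal.ofReal M < MeasureTheory.eLpNorm (u t) 3 MeasureTheory.volume := by
  intro C u h hne M
  by_contra! hcon
  -- `hcon : ∀ T < 0, ∃ t < T, eLpNorm (u t) 3 volume ≤ ENNReal.ofReal M`; pick `τ_k < -(k+1)`
  have hex : ∀ k : ℕ, ∃ t < -((k : ℝ) + 1), eLpNorm (u t) 3 volume ≤ ENNReal.ofReal M :=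
    fun k => hcon _ (by linarith [(Nat.cast_nonneg k : (0 : ℝ) ≤ k)])
  choose τ hτlt hτM using hex
  -- `τ_k → -∞`
  have hτ : Tendsto τ atTop atBot := by
    rw [tendsto_atTop_atBot]
    intro b
    refine ⟨⌈-b⌉₊, fun k hk => ?_⟩
    have h1 := hτlt k
    have h2 : (⌈-b⌉₊ : ℝ) ≤ k := by exact_mod_cast hk
    have h3 : -b ≤ ⌈-b⌉₊ := Nat.le_ceil _
    linarith
  -- A–B Thm 1.2 in the Type-I-rate Oseen-mild class: `u ≡ 0` on the open slab
  have h0 : ∀ t < 0, ∀ x, u t x = 0 :=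
    lebL3B_liouville_rate h.continuousOn_uncurry (fun t ht => h.isWeaklyDivFree ht)
      (fun s t hst ht x => h.mild_eq_heatExtension hst ht x) h.hasTypeITimeDecay
      ENNReal.ofReal_lt_top hτ hτM
  obtain ⟨t, ht, x, hx⟩ := hne
  exact hx (h0 t ht x)

end Summit.NavierStokesRegularity.NavierStokesRegularity.Theorems
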